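import Literature.NumberTheory.LFunctions.QuadraticClassNumberBernoulliCongruence
import Literature.NumberTheory.Congruences.BernoulliKummerCongruence
import Literature.NumberTheory.LFunctions.GeneralizedBernoulliNumbers
import Mathlib.NumberTheory.LegendreSymbol.Basic
import Mathlib.NumberTheory.Padics.PadicNumbers
import HarnessLib

/-!
# Crux `PrintCFram.BottomClassIndexLawFiveLe` (stmt-BirchSwinnertonDyer-20372), line `eisenstein-resource-bdp-line` (registry v21 → v22):
# THE `p`-ADIC VALUATION OF THE CUSP CONSTANT OF THE `m`-CUT COHEN–EISENSTEIN SERIES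
# (cell `bsd-print-cfram`, width seat `bsd-line-cfram-p1-w5` g5; THEOREMS ONLY, `--supports` 20372; BSD is not proved by any of this)

HONEST FRAMING. Registry v22 of the line (LEAD g12, `…HeegnerFieldSupplyCuspSplit`, p684982) splits the analytic residue
`stub_seedOff` by the predicate «some prime `ℓ ∣ m` has `ℓ % p = 1 ∨ ℓ % p = p − 1`»: OFF that set the seed is to come from the
EISENSTEIN CUSP SEED — the constant term at the cusp `0` of the `m`-cut Cohen–Eisenstein series `F_e(z) = Σ_{n'∈S'} H(k, m n') e(n'z)`
is a `p`-adic unit, so (q-expansion principle, Katz 1973) `F_e ≢ 0 (mod p)` and some `m`-admissible imaginary quadratic field has a unit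
field factor. The constant was computed and numerically certified (8 digits, 20 cases) by this seat (crux notes
`Lines/eisenstein-resource-bdp-line-w5g5-cusp-seed.md`): with `w = k + 1/2`,

  `lim_{y→0} y^w F_e(iy) = ± u'_k · 2^{−k−ω(m)−4+[2∣m]} · √(2m) · C`,
  `C := B_{2k}/k! · m^{k−1} · Π_{q ∣ m prime} (q−1)(q^{2k}−1)/q^{2k+1}`,

`u'_k = (⌈k/2⌉−1)!(2⌊k/2⌋)!/(4^{⌊k/2⌋}⌊k/2⌋!)` (a `p`-unit for `k < p`). THIS FILE proves, in the kernel, the arithmetic half of the cusp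
seed: for `p ≡ 3 (mod 4)`, `p ≥ 7`, `p ∤ m`, `2k ∈ {(p+1)/2, (3p−1)/2}` (the two weights `k ∈ {(p+1)/4, (3p−1)/4}` of the registry),

  **`v_p(C) = 0 ⟺ ¬ ∃ ℓ prime, ℓ ∣ m, (ℓ % p = 1 ∨ ℓ % p = p − 1)`** (`padicValuation_cuspConstant_eq_one_iff`),

and `C` is always `p`-integral (`padicValuation_cuspConstant_le_one`); i.e. the registry's split predicate IS the non-unit locus of the
cusp constant. Ingredients: (i) `B_{2k}` is a `p`-unit: for `2k = (p+1)/2` this is `p ∤ num B_{(p+1)/2}`, i.e. `p ∤ h(ℚ(√−p))`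
(`h(−p) ≡ −2B_{(p+1)/2} (mod p)` and `0 < h(−p) < p` — tree `QuadraticClassNumberBernoulliCongruence.not_dvd_bernoulli_num_half`; class number
ONE is not needed), and for `2k = (3p−1)/2` Kummer's congruence `B_{2k}/2k ≡ B_{(p+1)/2}/((p+1)/2) (mod p)` (tree
`KummerCongruence.kummer_congruence_one`); (ii) Euler's criterion: for a prime `ℓ ≠ p`, `p ∣ (ℓ−1)(ℓ^{2k}−1) ⟺ ℓ ≡ ±1 (mod p)`, because
`ℓ^{(p+1)/2} ≡ ℓ·(ℓ/p)` and `ℓ^{(3p−1)/2} ≡ ℓ^{(p+1)/2}` (`dvd_sub_one_mul_pow_sub_one_iff`); (iii) `k < p`, `p ∤ m`. Also: the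
auxiliary-prime factor `(r−1)(r^k ± 1)/(2r^{k+1})` of the cut excluding `d = −3` is a unit for `r ≢ 0, ±1 (mod p)`
(`padicValuation_auxFactor_eq_one`), and the `ℚ_p`-norm reading (`norm_eq_one_iff_padicValuation_eq_one`). What is NOT here: that `C` is
(up to the displayed unit and `√(2m)`) a cusp constant term of a modular form — half-integral weight forms and expansions at cusps are
not in the tree (typing owed, as for `stub_atP`). beyond-print theorem: NO. References: [Cohen1975] Thm. 3.1 (`H_k ∈ M_{k+1/2}(Γ₀(4))`);
[IrelandRosen1982] Ch. 15 §2 (Kummer's congruence, `h ≡ −2B_{(p+1)/2}`); [Cohen2007NumberTheoryII] §9.5.3 Cor. 9.5.22 and remark;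
[Washington1997] Cor. 5.14.
-/

set_option autoImplicit false
-- summit-side namespace `Summit.BirchSwinnertonDyer.BirchSwinnertonDyer.…` (single-conjunct summit, D-0017 layout)
set_option linter.dupNamespace false

noncomputable section

open WithZero Finset
open Literature.NumberTheory.LFunctions (padicValuation_natCast_eq_one)

namespace Summit.BirchSwinnertonDyer.BirchSwinnertonDyer.Theorems.PrintCFram.CuspSeed

variable {p : ℕ} [hp : Fact p.Prime]

/-! ## §1 Euler's criterion: the cusp-exceptional primes `ℓ ≡ ±1 (mod p)` -/

/-- For `p ≡ 3 (mod 4)` and `x ≠ 0` in `𝔽_p`: `x^{(p+1)/2} = 1 ⟺ x = ±1` (`x^{(p+1)/2} = x·x^{(p−1)/2} = ±x` by Euler's criterion,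
and `(p+1)/2` is even). [cite: IrelandRosen1982, Ch. 5 §1 Prop. 5.1.2 (Euler's criterion)] -/
theorem zmod_pow_succ_div_two_eq_one_iff (hp4 : p % 4 = 3) {x : ZMod p} (hx : x ≠ 0) :
    x ^ ((p + 1) / 2) = 1 ↔ x = 1 ∨ x = -1 := by
  have hsplit : (p + 1) / 2 = p / 2 + 1 := by omega
  have heven : Even ((p + 1) / 2) := ⟨(p + 1) / 4, by omega⟩
  constructor
  · intro h
    rw [hsplit, pow_succ] at h
    rcases ZMod.pow_div_two_eq_neg_one_or_one p hx with h1 | h1 <;> rw [h1] at h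
    · left
      simpa using h
    · right
      linear_combination -h
  · rintro (rfl | rfl)
    · exact one_pow _
    · exact heven.neg_one_pow

/-- In `𝔽_p`, `x^{(3p−1)/2} = x^{(p+1)/2}` for `x ≠ 0` (`(3p−1)/2 = (p−1) + (p+1)/2`, Fermat). [folklore] -/
theorem zmod_pow_three_mul_sub_one_div_two (hp4 : p % 4 = 3) {x : ZMod p} (hx : x ≠ 0) :
    x ^ ((3 * p - 1) / 2) = x ^ ((p + 1) / 2) := by
  have h : (3 * p - 1) / 2 = (p - 1) + (p + 1) / 2 := by omega
  rw [h, pow_add, ZMod.pow_card_sub_one_eq_one hx, one_mul]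

/-- `(ℓ : 𝔽_p) = 1 ⟺ ℓ % p = 1`. [folklore] -/
theorem natCast_zmod_eq_one_iff (ℓ : ℕ) : (ℓ : ZMod p) = 1 ↔ ℓ % p = 1 := by
  have h := ZMod.natCast_eq_natCast_iff' ℓ 1 p
  rw [Nat.cast_one, Nat.mod_eq_of_lt hp.out.one_lt] at h
  exact h

/-- `(ℓ : 𝔽_p) = −1 ⟺ ℓ % p = p − 1`. [folklore] -/
theorem natCast_zmod_eq_neg_one_iff (ℓ : ℕ) : (ℓ : ZMod p) = -1 ↔ ℓ % p = p - 1 := by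
  have h := ZMod.natCast_eq_natCast_iff' ℓ (p - 1) p
  have hp1 : ((p - 1 : ℕ) : ZMod p) = -1 := by
    rw [Nat.cast_sub hp.out.one_le, Nat.cast_one, ZMod.natCast_self, zero_sub]
  rw [hp1, Nat.mod_eq_of_lt (Nat.sub_lt hp.out.pos one_pos)] at h
  exact h

/-- **The exceptional primes.** For `p ≡ 3 (mod 4)`, a natural number `ℓ` prime to `p` and `n ∈ {(p+1)/2, (3p−1)/2}`:
`p ∣ (ℓ − 1)(ℓ^n − 1) ⟺ ℓ ≡ ±1 (mod p)`. This is the `ℓ`-Euler factor `(ℓ−1)(ℓ^{2k}−1)/ℓ^{2k+1}` of the cusp constant, `n = 2k`.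
[cite: IrelandRosen1982, Ch. 5 §1 Prop. 5.1.2 (Euler's criterion)] -/
theorem dvd_sub_one_mul_pow_sub_one_iff (hp4 : p % 4 = 3) {ℓ : ℕ} (hℓ : ¬ p ∣ ℓ) {n : ℕ}
    (hn : n = (p + 1) / 2 ∨ n = (3 * p - 1) / 2) :
    (p : ℤ) ∣ ((ℓ : ℤ) - 1) * ((ℓ : ℤ) ^ n - 1) ↔ ℓ % p = 1 ∨ ℓ % p = p - 1 := by
  have hx : (ℓ : ZMod p) ≠ 0 := by rwa [Ne, ZMod.natCast_eq_zero_iff]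
  rw [← ZMod.intCast_zmod_eq_zero_iff_dvd]
  push_cast
  rw [mul_eq_zero, sub_eq_zero, sub_eq_zero]
  have hpow : (ℓ : ZMod p) ^ n = (ℓ : ZMod p) ^ ((p + 1) / 2) := by
    rcases hn with rfl | rfl
    · rfl
    · exact zmod_pow_three_mul_sub_one_div_two hp4 hx
  rw [hpow, zmod_pow_succ_div_two_eq_one_iff hp4 hx, ← natCast_zmod_eq_one_iff (p := p) ℓ,
    ← natCast_zmod_eq_neg_one_iff (p := p) ℓ]
  tauto

/-! ## §2 The Bernoulli factor `B_{2k}`, `2k ∈ {(p+1)/2, (3p−1)/2}`, is a `p`-unit -/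

/-- **`v_p(B_{(p+1)/2}) = 0`** for `p ≡ 3 (mod 4)`, `p ≠ 3`: the numerator is prime to `p` because `h(ℚ(√−p)) ≡ −2B_{(p+1)/2} (mod p)`
and `0 < h(ℚ(√−p)) < p` (tree `not_dvd_bernoulli_num_half`), the denominator by von Staudt–Clausen (`p − 1 ∤ (p+1)/2`).
[cite: Cohen2007NumberTheoryII, §9.5.3, Cor. 9.5.22 and the remark following it] [cite: IrelandRosen1982, Ch. 15 §2] -/
theorem padicValuation_bernoulli_half_eq_one (hp4 : p % 4 = 3) (hp3 : p ≠ 3) :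
    Rat.padicValuation p (bernoulli ((p + 1) / 2)) = 1 := by
  have hnum :=
    Literature.NumberTheory.LFunctions.QuadraticClassNumberBernoulliCongruence.not_dvd_bernoulli_num_half hp4 hp3
  have hden : ¬ p ∣ (bernoulli ((p + 1) / 2)).den :=
    Literature.NumberTheory.Congruences.KummerCongruence.not_dvd_den_bernoulli (p := p) (m := (p + 1) / 2)
      (fun h ↦ by
        have := Nat.le_of_dvd (by omega) h
        omega)
  set q := bernoulli ((p + 1) / 2) with hq
  have hqd : (q.num : ℚ) / q.den = q := Rat.num_div_den q
  rw [← hqd, map_div₀, Rat.padicValuation_cast, Int.padicValuation_eq_one_iff.mpr hnum,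
    padicValuation_natCast_eq_one hden, div_one]

/-- **`v_p(B_n/n) = 0` for `n ∈ {(p+1)/2, (3p−1)/2}`**, `p ≡ 3 (mod 4)`, `p ≠ 3`: the first by `padicValuation_bernoulli_half_eq_one` and
`p ∤ (p+1)/2`; the second from the first by Kummer's congruence `B_n/n ≡ B_{n'}/n' (mod p)` for `n ≡ n' ≢ 0 (mod p − 1)` (tree
`KummerCongruence.kummer_congruence_one`), `(3p−1)/2 = (p+1)/2 + (p−1)`. [cite: IrelandRosen1982, Ch. 15 §2 Thm. 5] [cite: Washington1997, Cor. 5.14] -/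
theorem padicValuation_bernoulli_div_eq_one (hp4 : p % 4 = 3) (hp3 : p ≠ 3) {n : ℕ}
    (hn : n = (p + 1) / 2 ∨ n = (3 * p - 1) / 2) :
    Rat.padicValuation p (bernoulli n / n) = 1 := by
  have h7 : 7 ≤ p := by omega
  have hhalf : Rat.padicValuation p (bernoulli ((p + 1) / 2) / (((p + 1) / 2 : ℕ) : ℚ)) = 1 := by
    rw [map_div₀, padicValuation_bernoulli_half_eq_one hp4 hp3,
      padicValuation_natCast_eq_one (fun h ↦ by
        have := Nat.le_of_dvd (by omega) h
        omega), div_one]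
  rcases hn with rfl | rfl
  · exact hhalf
  · have hm : Even ((p + 1) / 2) := ⟨(p + 1) / 4, by omega⟩
    have hpm : ¬ (p - 1) ∣ (p + 1) / 2 := fun h ↦ by
      have := Nat.le_of_dvd (by omega) h
      omega
    have hmm' : (p + 1) / 2 ≡ (3 * p - 1) / 2 [MOD p - 1] := by
      rw [show (3 * p - 1) / 2 = (p + 1) / 2 + (p - 1) by omega]
      exact Nat.add_modEq_right.symm
    have hK := Literature.NumberTheory.Congruences.KummerCongruence.kummer_congruence_one (p := p) hm hpm hmm'
    have hlt : Rat.padicValuation p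
        (bernoulli ((3 * p - 1) / 2) / (((3 * p - 1) / 2 : ℕ) : ℚ) -
          bernoulli ((p + 1) / 2) / (((p + 1) / 2 : ℕ) : ℚ)) <
        Rat.padicValuation p (bernoulli ((p + 1) / 2) / (((p + 1) / 2 : ℕ) : ℚ)) := by
      rw [Valuation.map_sub_swap, hhalf]
      exact lt_of_le_of_lt hK (by rw [← exp_zero, exp_lt_exp]; norm_num)
    rw [Valuation.map_eq_of_sub_lt _ hlt, hhalf]

/-- **`v_p(B_{2k}) = 0` for `2k ∈ {(p+1)/2, (3p−1)/2}`**, `p ≡ 3 (mod 4)`, `p ≠ 3` (`p ∤ 2k`).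
[cite: IrelandRosen1982, Ch. 15 §2 Thm. 5] [cite: Cohen2007NumberTheoryII, §9.5.3, Cor. 9.5.22] -/
theorem padicValuation_bernoulli_eq_one (hp4 : p % 4 = 3) (hp3 : p ≠ 3) {n : ℕ}
    (hn : n = (p + 1) / 2 ∨ n = (3 * p - 1) / 2) :
    Rat.padicValuation p (bernoulli n) = 1 := by
  have h7 : 7 ≤ p := by omega
  have hn0 : (n : ℚ) ≠ 0 := by
    rcases hn with rfl | rfl <;> exact_mod_cast (show _ ≠ 0 by omega)
  have hnp : ¬ p ∣ n := by
    rintro ⟨c, hc⟩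
    have hc2 : c < 2 := by
      by_contra hc2
      have : p * 2 ≤ p * c := Nat.mul_le_mul_left p (by omega)
      rcases hn with rfl | rfl <;> omega
    interval_cases c <;> rcases hn with h | h <;> omega
  have h := padicValuation_bernoulli_div_eq_one hp4 hp3 hn
  rw [← div_mul_cancel₀ (bernoulli n) hn0, map_mul, h, padicValuation_natCast_eq_one hnp, one_mul]

/-! ## §3 The `ℓ`-Euler factors of the cusp constant -/

/-- The `ℓ`-factor `(ℓ−1)(ℓ^n−1)/ℓ^{n+1}` of the cusp constant is `p`-integral for `ℓ` prime to `p`. [folklore] -/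
theorem padicValuation_eulerFactor_le_one {ℓ : ℕ} (hℓ : ¬ p ∣ ℓ) (n : ℕ) :
    Rat.padicValuation p (((ℓ : ℚ) - 1) * ((ℓ : ℚ) ^ n - 1) / (ℓ : ℚ) ^ (n + 1)) ≤ 1 := by
  rw [map_div₀, map_pow, padicValuation_natCast_eq_one hℓ, one_pow, div_one,
    show ((ℓ : ℚ) - 1) * ((ℓ : ℚ) ^ n - 1) = ((((ℓ : ℤ) - 1) * ((ℓ : ℤ) ^ n - 1) : ℤ) : ℚ) by push_cast; ring,
    Rat.padicValuation_cast]
  exact Int.padicValuation_le_one p _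

/-- **The `ℓ`-factor is a unit iff `ℓ ≢ ±1 (mod p)`**: for `p ≡ 3 (mod 4)`, `ℓ` prime to `p`, `n ∈ {(p+1)/2, (3p−1)/2}`:
`v_p((ℓ−1)(ℓ^n−1)/ℓ^{n+1}) = 0 ⟺ ¬ (ℓ % p = 1 ∨ ℓ % p = p − 1)`. [cite: IrelandRosen1982, Ch. 5 §1 Prop. 5.1.2] -/
theorem padicValuation_eulerFactor_eq_one_iff (hp4 : p % 4 = 3) {ℓ : ℕ} (hℓ : ¬ p ∣ ℓ) {n : ℕ}
    (hn : n = (p + 1) / 2 ∨ n = (3 * p - 1) / 2) :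
    Rat.padicValuation p (((ℓ : ℚ) - 1) * ((ℓ : ℚ) ^ n - 1) / (ℓ : ℚ) ^ (n + 1)) = 1 ↔
      ¬ (ℓ % p = 1 ∨ ℓ % p = p - 1) := by
  rw [map_div₀, map_pow, padicValuation_natCast_eq_one hℓ, one_pow, div_one,
    show ((ℓ : ℚ) - 1) * ((ℓ : ℚ) ^ n - 1) = ((((ℓ : ℤ) - 1) * ((ℓ : ℤ) ^ n - 1) : ℤ) : ℚ) by push_cast; ring,
    Rat.padicValuation_cast, Int.padicValuation_eq_one_iff, dvd_sub_one_mul_pow_sub_one_iff hp4 hℓ hn]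

/-! ## §4 The cusp constant `C = B_{2k}/k! · m^{k−1} · Π_{q∣m} (q−1)(q^{2k}−1)/q^{2k+1}` -/

/-- **`C` is `p`-integral** (`p ≡ 3 (mod 4)`, `p ≠ 3`, `p ∤ m`, `k ∈ {(p+1)/4, (3p−1)/4}`): `B_{2k}`, `k!`, `m` are units and each
`ℓ`-factor is integral. [cite: Cohen1975, Thm. 3.1] [cite: IrelandRosen1982, Ch. 15 §2] -/
theorem padicValuation_cuspConstant_le_one (hp4 : p % 4 = 3) (hp3 : p ≠ 3) {m : ℕ} (hmp : m.Coprime p)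
    {k : ℕ} (hk : k = (p + 1) / 4 ∨ k = (3 * p - 1) / 4) :
    Rat.padicValuation p
      (bernoulli (2 * k) / (k.factorial : ℚ) * (m : ℚ) ^ (k - 1) *
        ∏ q ∈ m.primeFactors, ((q : ℚ) - 1) * ((q : ℚ) ^ (2 * k) - 1) / (q : ℚ) ^ (2 * k + 1)) ≤ 1 := by
  have h7 : 7 ≤ p := by omega
  have hn : 2 * k = (p + 1) / 2 ∨ 2 * k = (3 * p - 1) / 2 := by
    rcases hk with rfl | rfl
    · left; omega
    · right; omega
  have hkp : k < p := by omega
  have hfac : Rat.padicValuation p (k.factorial : ℚ) = 1 :=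
    padicValuation_natCast_eq_one (by rw [hp.out.dvd_factorial]; omega)
  have hmv : Rat.padicValuation p (m : ℚ) = 1 :=
    padicValuation_natCast_eq_one (fun h ↦ hp.out.ne_one (Nat.Coprime.eq_one_of_dvd hmp.symm h))
  have hq : ∀ q ∈ m.primeFactors, ¬ p ∣ q := fun q hq hpq ↦ by
    obtain ⟨hqprime, hqm, -⟩ := Nat.mem_primeFactors.mp hq
    have hpq' : p = q := (Nat.prime_dvd_prime_iff_eq hp.out hqprime).mp hpq
    exact hp.out.ne_one (Nat.Coprime.eq_one_of_dvd hmp.symm (hpq' ▸ hqm))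
  rw [map_mul, map_mul, map_div₀, padicValuation_bernoulli_eq_one hp4 hp3 hn, hfac, div_one, one_mul, map_pow,
    hmv, one_pow, one_mul, map_prod]
  exact Finset.prod_le_one' fun q hq' ↦ padicValuation_eulerFactor_le_one (hq q hq') _

/-- **MAIN — the non-unit locus of the cusp constant is registry v22's split predicate.** For `p ≡ 3 (mod 4)`, `p ≠ 3` (so
`p ≥ 7`), `m` prime to `p` and `k ∈ {(p+1)/4, (3p−1)/4}`:
`v_p(B_{2k}/k! · m^{k−1} · Π_{q∣m} (q−1)(q^{2k}−1)/q^{2k+1}) = 0 ⟺ ¬ ∃ ℓ prime, ℓ ∣ m, (ℓ % p = 1 ∨ ℓ % p = p − 1)`.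
Up to the unit `± u'_k 2^{−k−ω(m)−4+[2∣m]}` and the factor `√(2m)`, the rational number on the left is the constant term at the cusp `0`
of the `m`-cut Cohen–Eisenstein series of weight `k + 1/2` (crux notes `…-w5g5-cusp-seed.md`, not typed here); so on the classes with no
prime `ℓ ∣ m`, `ℓ ≡ ±1 (mod p)` that constant term is a `p`-unit — the arithmetic input of the cusp seed `(CuspSeed⁶)` of
`HeegnerFieldSupply.seedOff_six_of_cuspSeed_of_exc`. [cite: Cohen1975, Thm. 3.1] [cite: IrelandRosen1982, Ch. 15 §2 Thm. 5]
[cite: Cohen2007NumberTheoryII, §9.5.3, Cor. 9.5.22] -/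
theorem padicValuation_cuspConstant_eq_one_iff (hp4 : p % 4 = 3) (hp3 : p ≠ 3) {m : ℕ} (hm : m ≠ 0) (hmp : m.Coprime p)
    {k : ℕ} (hk : k = (p + 1) / 4 ∨ k = (3 * p - 1) / 4) :
    Rat.padicValuation p
      (bernoulli (2 * k) / (k.factorial : ℚ) * (m : ℚ) ^ (k - 1) *
        ∏ q ∈ m.primeFactors, ((q : ℚ) - 1) * ((q : ℚ) ^ (2 * k) - 1) / (q : ℚ) ^ (2 * k + 1)) = 1 ↔
    ¬ ∃ ℓ : ℕ, ℓ.Prime ∧ ℓ ∣ m ∧ (ℓ % p = 1 ∨ ℓ % p = p - 1) := by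
  have h7 : 7 ≤ p := by omega
  have hn : 2 * k = (p + 1) / 2 ∨ 2 * k = (3 * p - 1) / 2 := by
    rcases hk with rfl | rfl
    · left; omega
    · right; omega
  have hkp : k < p := by omega
  have hfac : Rat.padicValuation p (k.factorial : ℚ) = 1 :=
    padicValuation_natCast_eq_one (by rw [hp.out.dvd_factorial]; omega)
  have hmv : Rat.padicValuation p (m : ℚ) = 1 :=
    padicValuation_natCast_eq_one (fun h ↦ hp.out.ne_one (Nat.Coprime.eq_one_of_dvd hmp.symm h))
  have hq : ∀ q ∈ m.primeFactors, ¬ p ∣ q := fun q hq hpq ↦ by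
    obtain ⟨hqprime, hqm, -⟩ := Nat.mem_primeFactors.mp hq
    have hpq' : p = q := (Nat.prime_dvd_prime_iff_eq hp.out hqprime).mp hpq
    exact hp.out.ne_one (Nat.Coprime.eq_one_of_dvd hmp.symm (hpq' ▸ hqm))
  rw [map_mul, map_mul, map_div₀, padicValuation_bernoulli_eq_one hp4 hp3 hn, hfac, div_one, one_mul, map_pow,
    hmv, one_pow, one_mul, map_prod,
    Finset.prod_eq_one_iff_of_le_one' (fun q hq' ↦ padicValuation_eulerFactor_le_one (hq q hq') _)]
  constructor
  · rintro hall ⟨ℓ, hℓ, hℓm, hℓc⟩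
    have hmem : ℓ ∈ m.primeFactors := Nat.mem_primeFactors.mpr ⟨hℓ, hℓm, hm⟩
    exact (padicValuation_eulerFactor_eq_one_iff hp4 (hq ℓ hmem) hn).mp (hall ℓ hmem) hℓc
  · intro hno q hq'
    obtain ⟨hqprime, hqm, -⟩ := Nat.mem_primeFactors.mp hq'
    exact (padicValuation_eulerFactor_eq_one_iff hp4 (hq q hq') hn).mpr fun hc ↦ hno ⟨q, hqprime, hqm, hc⟩

/-- **The dichotomy**: under the same hypotheses the cusp constant is `p`-integral, and it is a NON-unit exactly on the classes with a
prime `ℓ ∣ m`, `ℓ ≡ ±1 (mod p)` (registry v22's `stub_seedOffExc`). [cite: Cohen1975, Thm. 3.1] [cite: IrelandRosen1982, Ch. 15 §2] -/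
theorem padicValuation_cuspConstant_lt_one_iff (hp4 : p % 4 = 3) (hp3 : p ≠ 3) {m : ℕ} (hm : m ≠ 0) (hmp : m.Coprime p)
    {k : ℕ} (hk : k = (p + 1) / 4 ∨ k = (3 * p - 1) / 4) :
    Rat.padicValuation p
      (bernoulli (2 * k) / (k.factorial : ℚ) * (m : ℚ) ^ (k - 1) *
        ∏ q ∈ m.primeFactors, ((q : ℚ) - 1) * ((q : ℚ) ^ (2 * k) - 1) / (q : ℚ) ^ (2 * k + 1)) < 1 ↔
    ∃ ℓ : ℕ, ℓ.Prime ∧ ℓ ∣ m ∧ (ℓ % p = 1 ∨ ℓ % p = p - 1) := by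
  have hle := padicValuation_cuspConstant_le_one hp4 hp3 hmp hk
  have hiff := padicValuation_cuspConstant_eq_one_iff hp4 hp3 hm hmp hk
  constructor
  · intro hlt
    by_contra h
    exact (lt_irrefl _) (lt_of_lt_of_eq hlt (hiff.mpr h).symm)
  · intro h
    exact lt_of_le_of_ne hle fun heq ↦ hiff.mp heq h

/-! ## §5 The auxiliary prime and the `ℚ_p`-norm reading -/

/-- **The auxiliary-prime factor is a unit.** When `d = −3` has to be cut out by a condition `(d/r) = η` at an auxiliary prime `r`, the
cusp constant acquires the factor `(r−1)(r^k + ε)/(2r^{k+1})`, `ε = χ_{e*}(r)η = ±1`; it is a `p`-unit as soon as `r ≢ 0, ±1 (mod p)`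
(`r^k ≡ ∓1 ⟹ r^{2k} ≡ 1 ⟹ r ≡ ±1`). [cite: IrelandRosen1982, Ch. 5 §1 Prop. 5.1.2] -/
theorem padicValuation_auxFactor_eq_one (hp4 : p % 4 = 3) {r : ℕ} (hrp : ¬ p ∣ r)
    (hr1 : ¬ (r % p = 1 ∨ r % p = p - 1)) {k : ℕ} (hk : 2 * k = (p + 1) / 2 ∨ 2 * k = (3 * p - 1) / 2)
    {ε : ℤ} (hε : ε = 1 ∨ ε = -1) :
    Rat.padicValuation p (((r : ℚ) - 1) * ((r : ℚ) ^ k + ε) / (2 * (r : ℚ) ^ (k + 1))) = 1 := by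
  have h3 : 3 ≤ p := by omega
  have hx : (r : ZMod p) ≠ 0 := by rwa [Ne, ZMod.natCast_eq_zero_iff]
  have h2 : Rat.padicValuation p (2 : ℚ) = 1 := by
    have := padicValuation_natCast_eq_one (p := p) (n := 2) (fun h ↦ by
      have := Nat.le_of_dvd two_pos h
      omega)
    exact_mod_cast this
  rw [show ((r : ℚ) - 1) * ((r : ℚ) ^ k + ε) = ((((r : ℤ) - 1) * ((r : ℤ) ^ k + ε) : ℤ) : ℚ) by push_cast; ring,
    map_div₀, map_mul, map_pow, h2, padicValuation_natCast_eq_one hrp, one_pow, mul_one, div_one,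
    Rat.padicValuation_cast, Int.padicValuation_eq_one_iff, ← ZMod.intCast_zmod_eq_zero_iff_dvd]
  push_cast
  rw [mul_eq_zero, sub_eq_zero, natCast_zmod_eq_one_iff]
  rintro (h | h)
  · exact hr1 (Or.inl h)
  · -- `r^k = −ε`, so `r^{2k} = ε² = 1`, so `r ≡ ±1`
    have hsq : (r : ZMod p) ^ (2 * k) = 1 := by
      rw [mul_comm, pow_mul, eq_neg_of_add_eq_zero_left h]
      rcases hε with rfl | rfl <;> push_cast <;> norm_num
    have hpow : (r : ZMod p) ^ (2 * k) = (r : ZMod p) ^ ((p + 1) / 2) := by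
      rcases hk with h' | h' <;> rw [h']
      exact zmod_pow_three_mul_sub_one_div_two hp4 hx
    rw [hpow, zmod_pow_succ_div_two_eq_one_iff hp4 hx, natCast_zmod_eq_one_iff, natCast_zmod_eq_neg_one_iff] at hsq
    exact hr1 hsq

/-- **`ℚ_p`-norm reading**: for a rational `x`, `v_p(x) = 0` (Mathlib's `Rat.padicValuation p x = 1`) iff `‖x‖ = 1` in `ℚ_p` — so the
MAIN theorem says `‖C‖_p = 1` off the exceptional set and `‖C‖_p ≤ p⁻¹` on it, in the currency of the registry's field factors. [folklore] -/
theorem norm_eq_one_iff_padicValuation_eq_one (x : ℚ) :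
    ‖(x : ℚ_[p])‖ = 1 ↔ Rat.padicValuation p x = 1 := by
  by_cases hx : x = 0
  · subst hx
    simp
  · rw [Padic.eq_padicNorm, show (1 : ℝ) = ((1 : ℚ) : ℝ) by norm_num, Rat.cast_inj, padicNorm.eq_zpow_of_nonzero hx]
    simp only [Rat.padicValuation, Valuation.coe_mk, MonoidWithZeroHom.coe_mk, ZeroHom.coe_mk, hx, if_false]
    rw [← exp_zero, exp_injective.eq_iff, neg_eq_zero,
      zpow_eq_one_iff_right₀ (by exact_mod_cast hp.out.pos.le) (by exact_mod_cast hp.out.ne_one), neg_eq_zero]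

end Summit.BirchSwinnertonDyer.BirchSwinnertonDyer.Theorems.PrintCFram.CuspSeed

end
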